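import Mathlib
import HarnessLib
import Literature.Analysis.FluidPDE.Vorticity
import Literature.Analysis.FluidPDE.VorticityEquation
import Literature.Analysis.FluidPDE.SpaceTimeCalculus
import Literature.Analysis.FluidPDE.EnstrophySplitting
import Summits.NavierStokesRegularity.NavierStokesRegularity.Theorems.HalfSpaceWindowDoorCirculationCarryingRigidityPlaneLaplacian
import Summits.NavierStokesRegularity.NavierStokesRegularity.Theorems.ChiralWindowDoorClassDerivDecay
import Summits.NavierStokesRegularity.NavierStokesRegularity.Theorems.PoloidalWindowDoorPoloidalWindowRigidityClassSpaceTimeRates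

/-!
# Route `HalfSpaceWindowDoor`, crux `CirculationCarryingRigidity` (stmt-NavierStokesRegularity-25311) — the DYNAMIC
# windowed plane-flux law (exact time derivative of the Gaussian-windowed `e₃`-flux through a horizontal plane)

For a solution of the vorticity formulation on `(−∞,0)` (in particular for every profile of the door's Type-I ancient
Oseen-mild class) the centred windowed plane flux `Ψ_L(c,t) = ∫ ⟪curl v(t)(y,c), e₃⟫ g_{L,0}(y) dy` is differentiable in
time, with

  `∂ₜΨ_L(c,t) = −Σᵢ ∫ ∂ᵢω₃ ∂ᵢg + Σⱼ ∫ ∂₃ωⱼ ∂ⱼg + Σⱼ ∫ Fⱼ ∂ⱼg`,  `Fⱼ = vⱼω₃ − ωⱼv₃`, `i, j ∈ {0,1}`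

(`hasDerivAt_windowedFlux_time`, `…_of_class`): differentiate under the integral (the `e₃`-component of the vorticity
equation `∂ₜω₃ = Δω₃ − [(v·∇)ω − (ω·∇)v]₃`, `…SubcriticalStretching.hasDerivAt_inner_curl_e3`, dominated on a time
neighbourhood by class sup bounds × the window), then split the Laplacian term by `…PlaneLaplacian` (in-plane IBP and
`∂₃²ω₃ = −∂₀(∂₃ω₀) − ∂₁(∂₃ω₁)`) and the transport–tilting term by g0's `…TiltingFlux` (`[(v·∇)ω − (ω·∇)v]₃ = ∂₀F₀ + ∂₁F₁`).
Every term pairs a bounded field with the window GRADIENT (`‖∇g_{L,0}‖₁ ≤ 2/L`) except the vertical one, which is a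
HEIGHT DERIVATIVE: `Σⱼ ∫ ∂₃ωⱼ ∂ⱼg = ∂_c Σⱼ ∫ ωⱼ ∂ⱼg` — the structure behind the route's «plane-flux heat law»
(`Φ_t = Φ_cc` for the plane circulation in the space–time Type-I subclass; kinematic half `…PlaneFluxHeight`).

Seat ns-hsw-p1 g2 (LEAD of 25311, cell pub-ns-dss).  WHAT THIS IS NOT: no estimate and no statement about Navier–Stokes
regularity — an exact identity for smooth solutions / HYPOTHETICAL blow-up profiles; helper `--supports` 25311.
-/

noncomputable section

-- the summit and its single sub-problem share the name (CONVENTIONS §1), as in every Theorems file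
set_option linter.dupNamespace false

namespace Summit.NavierStokesRegularity.NavierStokesRegularity.Theorems.HalfSpaceWindowDoorCirculationCarryingRigidityPlaneFluxDynamics

open MeasureTheory Set Function Filter Topology Metric
open scoped RealInnerProductSpace InnerProductSpace ENNReal Laplacian ContDiff
open Literature.Analysis Literature.Analysis.FluidPDE Literature.Analysis.UnboundedOperators
open Summit.NavierStokesRegularity.NavierStokesRegularity.Theorems.HalfSpaceWindowDoorCirculationCarryingRigidityDefs
open Summit.NavierStokesRegularity.NavierStokesRegularity.Theorems.HalfSpaceWindowDoorCirculationCarryingRigidityWindowedFlux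
  (gaussWin_pos continuous_gaussWin integrable_gaussWin continuous_planePt)
open Summit.NavierStokesRegularity.NavierStokesRegularity.Theorems.HalfSpaceWindowDoorCirculationCarryingRigidityTiltingFlux
  (integral_convect_sub_stretch_two_mul_gaussWin)
open Summit.NavierStokesRegularity.NavierStokesRegularity.Theorems.HalfSpaceWindowDoorCirculationCarryingRigiditySubcriticalStretching
  (hasDerivAt_inner_curl_e3 fderiv_inner_e3_apply laplacian_inner_e3)
open Summit.NavierStokesRegularity.NavierStokesRegularity.Theorems.HalfSpaceWindowDoorCirculationCarryingRigidityPlaneFluxHeightWindow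
  (inner_e3_eq_apply abs_inner_e3_le contDiff_one_curl)
open Summit.NavierStokesRegularity.NavierStokesRegularity.Theorems.HalfSpaceWindowDoorCirculationCarryingRigidityPlaneLaplacian
  (contDiff_two_curl norm_iteratedFDeriv_two_inner_e3_le integral_laplacian_omega3_mul_gaussWin)
open Summit.NavierStokesRegularity.NavierStokesRegularity.Theorems.LocalSineTubeDoorProfileAlignedWindowRigidityAncient
  (bdd_of_hasTypeITimeDecay analyticOnNhd_slice)
open Summit.NavierStokesRegularity.NavierStokesRegularity.Theorems.PoloidalWindowDoorPoloidalWindowRigidityClassSpaceTimeRates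
  (exists_fderiv_rate_of_class' exists_iteratedFDeriv_two_rate_of_class' exists_iteratedFDeriv_three_rate_of_class)
open Summit.NavierStokesRegularity.NavierStokesRegularity.Theorems.ChiralWindowDoorClassDerivDecay (exists_classical_of_class)

variable {v : ℝ → EuclideanSpace ℝ (Fin 3) → EuclideanSpace ℝ (Fin 3)}

/-! ### The pointwise rate in transport–stretching form -/

/-- **`∂ₜω₃ = Δω₃ − [((v·∇)ω)₃ − ((ω·∇)v)₃]`** pointwise for a vorticity solution on `(−∞,0)` (the `e₃`-component of the
vorticity equation, `hasDerivAt_inner_curl_e3`, with `Dω₃[v] = ((v·∇)ω)₃` and `⟪Dv[ω], e₃⟫ = ((ω·∇)v)₃`).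
[cite: MajdaBertozziCUP2002, Prop. 2.4 eq. (2.110); folklore] -/
theorem hasDerivAt_inner_curl_e3_convect (hV : IsVorticitySolutionOn (Iio (0 : ℝ)) 1 v) {s : ℝ} (hs : s < 0)
    (x : EuclideanSpace ℝ (Fin 3)) :
    HasDerivAt (fun σ => ⟪curl (v σ) x, e3⟫)
      ((Δ fun z => ⟪curl (v s) z, e3⟫) x - (convect (v s) (curl (v s)) x 2 - convect (curl (v s)) (v s) x 2)) s := by
  have hω : IsSmoothSpaceTimeOn (Iio (0 : ℝ)) (vorticity v) :=
    hV.smooth_velocity.isSmoothSpaceTimeOn_vorticity isOpen_Iio.uniqueDiffOn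
  have hωd : Differentiable ℝ (curl (v s)) := (hω.contDiff_slice hs).differentiable (by simp)
  have h := hasDerivAt_inner_curl_e3 hV hs x
  have h1 : fderiv ℝ (fun z => ⟪curl (v s) z, e3⟫) x (v s x) = convect (v s) (curl (v s)) x 2 := by
    rw [fderiv_inner_e3_apply (hωd x), inner_e3_eq_apply, convect_apply]
  have h2 : ⟪fderiv ℝ (v s) x (curl (v s) x), e3⟫ = convect (curl (v s)) (v s) x 2 := by
    rw [inner_e3_eq_apply, convect_apply]
  rw [h1, h2] at h
  convert h using 1
  ring

/-! ### The dynamic windowed plane-flux law -/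

/-- **DYNAMIC WINDOWED PLANE-FLUX LAW.**  Let `v` solve the vorticity formulation (unit viscosity) on `(−∞,0)`, `t < 0`, and
suppose on a time neighbourhood `(t−δ, t+δ) ⊆ (−∞,0)` the velocity, its gradient, the vorticity and its first two derivatives
are uniformly bounded.  Then for `L > 0` and every height `c` the windowed plane flux `Ψ_L(c,·) = ∫ ⟪curl v(·)(y,c), e₃⟫ g_{L,0}(y) dy`
is differentiable at `t` with derivative
`[−(∫∂₀ω₃∂₀g + ∫∂₁ω₃∂₁g) + (∫∂₃ω₀∂₀g + ∫∂₃ω₁∂₁g)] − [−∫F₀∂₀g − ∫F₁∂₁g]`, `Fⱼ = vⱼω₃ − ωⱼv₃` (fields at time `t`, evaluated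
at `(y,c)`; window derivatives at `y`). [cite: MajdaBertozziCUP2002, Prop. 2.4 eq. (2.110); folklore] -/
theorem hasDerivAt_windowedFlux_time (hV : IsVorticitySolutionOn (Iio (0 : ℝ)) 1 v) {t δ : ℝ} (hδ : 0 < δ)
    (hδt : t + δ < 0) {Bu Mu Bw Mw Mw2 : ℝ}
    (hBu : ∀ s ∈ Ioo (t - δ) (t + δ), ∀ x, ‖v s x‖ ≤ Bu)
    (hMu : ∀ s ∈ Ioo (t - δ) (t + δ), ∀ x, ‖fderiv ℝ (v s) x‖ ≤ Mu)
    (hBw : ∀ s ∈ Ioo (t - δ) (t + δ), ∀ x, ‖curl (v s) x‖ ≤ Bw)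
    (hMw : ∀ s ∈ Ioo (t - δ) (t + δ), ∀ x, ‖fderiv ℝ (curl (v s)) x‖ ≤ Mw)
    (hMw2 : ∀ s ∈ Ioo (t - δ) (t + δ), ∀ x, ‖iteratedFDeriv ℝ 2 (curl (v s)) x‖ ≤ Mw2)
    {L : ℝ} (hL : 0 < L) (c : ℝ) :
    HasDerivAt (fun s => ∫ y, ⟪curl (v s) (planePt c y), e3⟫ * gaussWin L 0 y)
      ((-((∫ y, fderiv ℝ (fun z => ⟪curl (v t) z, e3⟫) (planePt c y) (EuclideanSpace.single 0 1) *
              fderiv ℝ (gaussWin L 0) y (EuclideanSpace.single 0 1)) +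
            ∫ y, fderiv ℝ (fun z => ⟪curl (v t) z, e3⟫) (planePt c y) (EuclideanSpace.single 1 1) *
              fderiv ℝ (gaussWin L 0) y (EuclideanSpace.single 1 1)) +
          ((∫ y, fderiv ℝ (fun z => curl (v t) z 0) (planePt c y) e3 * fderiv ℝ (gaussWin L 0) y (EuclideanSpace.single 0 1)) +
            ∫ y, fderiv ℝ (fun z => curl (v t) z 1) (planePt c y) e3 * fderiv ℝ (gaussWin L 0) y (EuclideanSpace.single 1 1))) -
        (-(∫ y, (v t (planePt c y) 0 * curl (v t) (planePt c y) 2 - curl (v t) (planePt c y) 0 * v t (planePt c y) 2) *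
              fderiv ℝ (gaussWin L 0) y (EuclideanSpace.single 0 1)) -
          ∫ y, (v t (planePt c y) 1 * curl (v t) (planePt c y) 2 - curl (v t) (planePt c y) 1 * v t (planePt c y) 2) *
              fderiv ℝ (gaussWin L 0) y (EuclideanSpace.single 1 1))) t := by
  have ht : t < 0 := by linarith
  have htI : t ∈ Ioo (t - δ) (t + δ) := ⟨by linarith, by linarith⟩
  have hIneg : ∀ s ∈ Ioo (t - δ) (t + δ), s < 0 := fun s hs => lt_trans hs.2 hδt
  have hu : IsSmoothSpaceTimeOn (Iio (0 : ℝ)) v := hV.smooth_velocity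
  have hω : IsSmoothSpaceTimeOn (Iio (0 : ℝ)) (vorticity v) := hu.isSmoothSpaceTimeOn_vorticity isOpen_Iio.uniqueDiffOn
  -- slices
  have hvs : ∀ s < (0 : ℝ), ContDiff ℝ ∞ (v s) := fun s hs => hu.contDiff_slice hs
  have hωs : ∀ s < (0 : ℝ), ContDiff ℝ ∞ (curl (v s)) := fun s hs => hω.contDiff_slice hs
  have hω2 : ∀ s < (0 : ℝ), ContDiff ℝ 2 (curl (v s)) := fun s hs => (hωs s hs).of_le (by norm_cast)
  have hf2 : ∀ s < (0 : ℝ), ContDiff ℝ 2 (fun z => ⟪curl (v s) z, e3⟫) := fun s hs => (hω2 s hs).inner ℝ contDiff_const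
  -- the pointwise rate and its bound on the neighbourhood
  set D : ℝ → EuclideanSpace ℝ (Fin 3) → ℝ := fun s x =>
    (Δ fun z => ⟪curl (v s) z, e3⟫) x - (convect (v s) (curl (v s)) x 2 - convect (curl (v s)) (v s) x 2) with hD
  set B : ℝ := 3 * Mw2 + (Mw * Bu + Mu * Bw) with hB
  have hDb : ∀ s ∈ Ioo (t - δ) (t + δ), ∀ x, |D s x| ≤ B := by
    intro s hs x
    have hs0 := hIneg s hs
    have h1 : |(Δ fun z => ⟪curl (v s) z, e3⟫) x| ≤ 3 * Mw2 := by
      rw [← Real.norm_eq_abs]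
      calc ‖(Δ fun z => ⟪curl (v s) z, e3⟫) x‖ ≤ 3 * ‖iteratedFDeriv ℝ 2 (fun z => ⟪curl (v s) z, e3⟫) x‖ :=
            norm_laplacian_le_three_mul_norm_iteratedFDeriv_two (hf2 s hs0) x
        _ ≤ 3 * ‖iteratedFDeriv ℝ 2 (curl (v s)) x‖ := by gcongr; exact norm_iteratedFDeriv_two_inner_e3_le (hω2 s hs0) x
        _ ≤ 3 * Mw2 := by gcongr; exact hMw2 s hs x
    have h2 : |convect (v s) (curl (v s)) x 2| ≤ Mw * Bu := by
      rw [convect_apply, ← Real.norm_eq_abs]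
      calc ‖fderiv ℝ (curl (v s)) x (v s x) 2‖ ≤ ‖fderiv ℝ (curl (v s)) x (v s x)‖ := PiLp.norm_apply_le _ _
        _ ≤ ‖fderiv ℝ (curl (v s)) x‖ * ‖v s x‖ := ContinuousLinearMap.le_opNorm _ _
        _ ≤ Mw * Bu := mul_le_mul (hMw s hs x) (hBu s hs x) (norm_nonneg _) ((norm_nonneg _).trans (hMw s hs x))
    have h3 : |convect (curl (v s)) (v s) x 2| ≤ Mu * Bw := by
      rw [convect_apply, ← Real.norm_eq_abs]
      calc ‖fderiv ℝ (v s) x (curl (v s) x) 2‖ ≤ ‖fderiv ℝ (v s) x (curl (v s) x)‖ := PiLp.norm_apply_le _ _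
        _ ≤ ‖fderiv ℝ (v s) x‖ * ‖curl (v s) x‖ := ContinuousLinearMap.le_opNorm _ _
        _ ≤ Mu * Bw := mul_le_mul (hMu s hs x) (hBw s hs x) (norm_nonneg _) ((norm_nonneg _).trans (hMu s hs x))
    simp only [hD]
    calc |(Δ fun z => ⟪curl (v s) z, e3⟫) x - (convect (v s) (curl (v s)) x 2 - convect (curl (v s)) (v s) x 2)|
        ≤ |(Δ fun z => ⟪curl (v s) z, e3⟫) x| + |convect (v s) (curl (v s)) x 2 - convect (curl (v s)) (v s) x 2| := abs_sub _ _
      _ ≤ |(Δ fun z => ⟪curl (v s) z, e3⟫) x| + (|convect (v s) (curl (v s)) x 2| + |convect (curl (v s)) (v s) x 2|) := by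
          gcongr; exact abs_sub _ _
      _ ≤ 3 * Mw2 + (Mw * Bu + Mu * Bw) := add_le_add h1 (add_le_add h2 h3)
  -- differentiation under the integral sign
  set F : ℝ → EuclideanSpace ℝ (Fin 2) → ℝ := fun s y => ⟪curl (v s) (planePt c y), e3⟫ * gaussWin L 0 y with hF
  set F' : ℝ → EuclideanSpace ℝ (Fin 2) → ℝ := fun s y => D s (planePt c y) * gaussWin L 0 y with hF'
  have hFc : ∀ s < (0 : ℝ), Continuous (F s) := fun s hs =>
    (((hωs s hs).continuous.comp (continuous_planePt c)).inner continuous_const).mul (continuous_gaussWin L 0)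
  have hDc : Continuous (D t) := by
    have hΔ : Continuous (Δ fun z => ⟪curl (v t) z, e3⟫) := continuous_laplacian (hf2 t ht)
    have hc1 : Continuous fun x => convect (v t) (curl (v t)) x 2 := by
      have h : Continuous fun x => convect (v t) (curl (v t)) x := by
        simp_rw [convect_apply]
        exact ((hω2 t ht).continuous_fderiv two_ne_zero).clm_apply (hvs t ht).continuous
      exact (EuclideanSpace.proj (𝕜 := ℝ) (2 : Fin 3)).continuous.comp h
    have hc2 : Continuous fun x => convect (curl (v t)) (v t) x 2 := by
      have h : Continuous fun x => convect (curl (v t)) (v t) x := by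
        simp_rw [convect_apply]
        exact ((hvs t ht).continuous_fderiv (by simp)).clm_apply (hω2 t ht).continuous
      exact (EuclideanSpace.proj (𝕜 := ℝ) (2 : Fin 3)).continuous.comp h
    simp only [hD]
    exact hΔ.sub (hc1.sub hc2)
  have hF'c : Continuous (F' t) := (hDc.comp (continuous_planePt c)).mul (continuous_gaussWin L 0)
  have hFint : Integrable (F t) := by
    refine Integrable.mono' ((integrable_gaussWin hL 0).const_mul Bw) (hFc t ht).aestronglyMeasurable (ae_of_all _ fun y => ?_)
    simp only [hF]
    rw [norm_mul, Real.norm_eq_abs, Real.norm_eq_abs, abs_of_pos (gaussWin_pos hL 0 y)]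
    exact mul_le_mul_of_nonneg_right ((abs_inner_e3_le _).trans (hBw t htI _)) (gaussWin_pos hL 0 y).le
  have hball : ball t δ = Ioo (t - δ) (t + δ) := Real.ball_eq_Ioo t δ
  have hmeas : ∀ᶠ s in 𝓝 t, AEStronglyMeasurable (F s) volume := by
    filter_upwards [Iio_mem_nhds ht] with s hs using (hFc s hs).aestronglyMeasurable
  have hbound : ∀ᵐ y ∂(volume : Measure (EuclideanSpace ℝ (Fin 2))), ∀ s ∈ ball t δ, ‖F' s y‖ ≤ B * gaussWin L 0 y := by
    refine ae_of_all _ fun y s hs => ?_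
    rw [hball] at hs
    simp only [hF']
    rw [norm_mul, Real.norm_eq_abs, Real.norm_eq_abs, abs_of_pos (gaussWin_pos hL 0 y)]
    exact mul_le_mul_of_nonneg_right (hDb s hs _) (gaussWin_pos hL 0 y).le
  have hdiff : ∀ᵐ y ∂(volume : Measure (EuclideanSpace ℝ (Fin 2))), ∀ s ∈ ball t δ,
      HasDerivAt (fun σ => F σ y) (F' s y) s := by
    refine ae_of_all _ fun y s hs => ?_
    rw [hball] at hs
    exact (hasDerivAt_inner_curl_e3_convect hV (hIneg s hs) (planePt c y)).mul_const _
  have hD' := (hasDerivAt_integral_of_dominated_loc_of_deriv_le (μ := volume) (F := F) (F' := F') (x₀ := t)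
    (s := ball t δ) (ball_mem_nhds t hδ) hmeas hFint hF'c.aestronglyMeasurable hbound
    ((integrable_gaussWin hL 0).const_mul B) hdiff).2
  -- the value of the derivative: Laplacian part and transport–tilting part
  have hv3 : ContDiff ℝ 3 (v t) := (hvs t ht).of_le (by norm_cast)
  have hv1 : ContDiff ℝ 1 (v t) := (hvs t ht).of_le (by norm_cast)
  have hw1 : ContDiff ℝ 1 (curl (v t)) := (hωs t ht).of_le (by norm_cast)
  have hdivu : VectorCalculus.IsDivFree (v t) := hV.divFree t ht
  have hdivw : VectorCalculus.IsDivFree (curl (v t)) := fun x =>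
    divergence_curl_eq_zero_holds (v t) ((hvs t ht).of_le (by norm_cast)) x
  obtain ⟨hLint, hLeq⟩ := integral_laplacian_omega3_mul_gaussWin hv3 (hMw t htI) (hMw2 t htI) hL c
  obtain ⟨hTint, hTeq⟩ := integral_convect_sub_stretch_two_mul_gaussWin hv1 hw1 (hBu t htI) (hBw t htI) (hMu t htI)
    (hMw t htI) hdivu hdivw hL c 0
  have hval : ∫ y, F' t y =
      (∫ y, (Δ fun z => ⟪curl (v t) z, e3⟫) (planePt c y) * gaussWin L 0 y) -
        ∫ y, (convect (v t) (curl (v t)) (planePt c y) 2 - convect (curl (v t)) (v t) (planePt c y) 2) * gaussWin L 0 y := by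
    rw [← integral_sub hLint hTint]
    refine integral_congr_ae (ae_of_all _ fun y => ?_)
    simp only [hF', hD]
    ring
  rw [hval, hLeq, hTeq] at hD'
  exact hD'

/-- `‖D²(curl V)(x)‖ ≤ ‖curlCLM‖ ‖D³V(x)‖` for a `C³` field. -/
theorem norm_iteratedFDeriv_two_curl_le {V : EuclideanSpace ℝ (Fin 3) → EuclideanSpace ℝ (Fin 3)} (hV : ContDiff ℝ 3 V)
    (x : EuclideanSpace ℝ (Fin 3)) : ‖iteratedFDeriv ℝ 2 (curl V) x‖ ≤ ‖curlCLM‖ * ‖iteratedFDeriv ℝ 3 V x‖ := by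
  rw [curl_eq_curlCLM_comp]
  refine (ContinuousLinearMap.norm_iteratedFDeriv_comp_left curlCLM
    ((hV.fderiv_right (m := 2) (by norm_cast)).contDiffAt) le_rfl).trans ?_
  rw [norm_iteratedFDeriv_fderiv]

/-- **The dynamic windowed plane-flux law for the door's Type-I ancient Oseen-mild class.**  Every profile of the route's
class is a vorticity solution on `(−∞,0)` with the class sup-rates, so `hasDerivAt_windowedFlux_time` applies at every
`t < 0` (neighbourhood `(3t/2, t/2)`), for every `L > 0` and height `c`.
[cite: MajdaBertozziCUP2002, Prop. 2.4 eq. (2.110); folklore] -/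
theorem hasDerivAt_windowedFlux_time_of_class :
    ∀ (C : ℝ) (v : ℝ → EuclideanSpace ℝ (Fin 3) → EuclideanSpace ℝ (Fin 3)),
    Literature.Analysis.FluidPDE.HasTypeITimeDecay C v →
    ContinuousOn (Function.uncurry v) (Set.Iio (0 : ℝ) ×ˢ Set.univ) →
    (∀ s t : ℝ, s < t → t < 0 → ∀ x, v t x =
      Literature.Analysis.UnboundedOperators.heatExtension (v s) (t - s) x -
        Literature.Analysis.FluidPDE.oseenDuhamel 1 s v v t x) →
    (∀ t < 0, Literature.Analysis.FluidPDE.VectorCalculus.IsDivFree (v t)) →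
    ∀ t < 0, ∀ L : ℝ, 0 < L → ∀ c : ℝ,
      HasDerivAt (fun s => ∫ y, ⟪Literature.Analysis.FluidPDE.curl (v s) (planePt c y), e3⟫_ℝ * gaussWin L 0 y)
        ((-((∫ y, fderiv ℝ (fun z => ⟪Literature.Analysis.FluidPDE.curl (v t) z, e3⟫_ℝ) (planePt c y) (EuclideanSpace.single 0 1) *
                fderiv ℝ (gaussWin L 0) y (EuclideanSpace.single 0 1)) +
              ∫ y, fderiv ℝ (fun z => ⟪Literature.Analysis.FluidPDE.curl (v t) z, e3⟫_ℝ) (planePt c y) (EuclideanSpace.single 1 1) *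
                fderiv ℝ (gaussWin L 0) y (EuclideanSpace.single 1 1)) +
            ((∫ y, fderiv ℝ (fun z => Literature.Analysis.FluidPDE.curl (v t) z 0) (planePt c y) e3 *
                fderiv ℝ (gaussWin L 0) y (EuclideanSpace.single 0 1)) +
              ∫ y, fderiv ℝ (fun z => Literature.Analysis.FluidPDE.curl (v t) z 1) (planePt c y) e3 *
                fderiv ℝ (gaussWin L 0) y (EuclideanSpace.single 1 1))) -
          (-(∫ y, (v t (planePt c y) 0 * Literature.Analysis.FluidPDE.curl (v t) (planePt c y) 2 -
                  Literature.Analysis.FluidPDE.curl (v t) (planePt c y) 0 * v t (planePt c y) 2) *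
                fderiv ℝ (gaussWin L 0) y (EuclideanSpace.single 0 1)) -
            ∫ y, (v t (planePt c y) 1 * Literature.Analysis.FluidPDE.curl (v t) (planePt c y) 2 -
                  Literature.Analysis.FluidPDE.curl (v t) (planePt c y) 1 * v t (planePt c y) 2) *
                fderiv ℝ (gaussWin L 0) y (EuclideanSpace.single 1 1))) t := by
  intro C v hrate hcont hmild hdiv t ht L hL c
  -- the class is classical, hence a vorticity solution
  obtain ⟨q, hcl⟩ := exists_classical_of_class hrate hcont hmild hdiv
  have hV : IsVorticitySolutionOn (Iio (0 : ℝ)) 1 v :=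
    hcl.isVorticitySolutionOn_zero_force isOpen_Iio.uniqueDiffOn (by rw [interior_Iio]; exact subset_closure)
  -- class rates
  obtain ⟨K₁, hK₁0, hK₁⟩ := exists_fderiv_rate_of_class' hrate hcont hmild
  obtain ⟨K₂, hK₂0, hK₂⟩ := exists_iteratedFDeriv_two_rate_of_class' hrate hcont hmild
  obtain ⟨K₃, hK₃0, hK₃⟩ := exists_iteratedFDeriv_three_rate_of_class hrate hcont hmild
  have hC0 : 0 ≤ C := by
    have h := hrate (-1) (by norm_num) 0
    rw [neg_neg, Real.sqrt_one, div_one] at h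
    exact (norm_nonneg _).trans h
  -- the neighbourhood `(t − δ, t + δ)`, `δ = −t/2`, where `−s ≥ m := −t/2`
  set δ : ℝ := -t / 2 with hδ
  have hδ0 : 0 < δ := by rw [hδ]; linarith
  have hδt : t + δ < 0 := by rw [hδ]; linarith
  set m : ℝ := -t / 2 with hm
  have hm0 : 0 < m := by rw [hm]; linarith
  have hms : ∀ s ∈ Ioo (t - δ) (t + δ), m ≤ -s ∧ s < 0 := by
    intro s hs
    constructor
    · rw [hm]; linarith [hs.2]
    · linarith [hs.2]
  have hsm : ∀ s ∈ Ioo (t - δ) (t + δ), ContDiff ℝ 3 (v s) := by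
    intro s hs
    have hA := analyticOnNhd_slice hcont (bdd_of_hasTypeITimeDecay hrate) hmild (hms s hs).2
    exact contDiff_iff_contDiffAt.2 fun x => (hA x (mem_univ x)).contDiffAt
  -- uniform bounds on the neighbourhood
  have hBu : ∀ s ∈ Ioo (t - δ) (t + δ), ∀ x, ‖v s x‖ ≤ C / Real.sqrt m := by
    intro s hs x
    obtain ⟨hle, hs0⟩ := hms s hs
    exact (hrate s hs0 x).trans (div_le_div_of_nonneg_left hC0 (Real.sqrt_pos.2 hm0) (Real.sqrt_le_sqrt hle))
  have hMu : ∀ s ∈ Ioo (t - δ) (t + δ), ∀ x, ‖fderiv ℝ (v s) x‖ ≤ K₁ / m := by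
    intro s hs x
    obtain ⟨hle, hs0⟩ := hms s hs
    exact (hK₁ s hs0 x).trans (div_le_div_of_nonneg_left hK₁0 hm0 hle)
  have hBw : ∀ s ∈ Ioo (t - δ) (t + δ), ∀ x, ‖curl (v s) x‖ ≤ 4 * (K₁ / m) := fun s hs x =>
    (norm_curl_le_four_mul (v s) x).trans (mul_le_mul_of_nonneg_left (hMu s hs x) (by norm_num))
  have hMw : ∀ s ∈ Ioo (t - δ) (t + δ), ∀ x, ‖fderiv ℝ (curl (v s)) x‖ ≤ ‖curlCLM‖ * (K₂ / (m * Real.sqrt m)) := by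
    intro s hs x
    obtain ⟨hle, hs0⟩ := hms s hs
    refine (FluidPDE.norm_fderiv_curl_le ((hsm s hs).of_le (by norm_cast)) x).trans
      (mul_le_mul_of_nonneg_left ?_ (norm_nonneg curlCLM))
    refine (hK₂ s hs0 x).trans (div_le_div_of_nonneg_left hK₂0 (by positivity) ?_)
    exact mul_le_mul hle (Real.sqrt_le_sqrt hle) (Real.sqrt_nonneg _) (by linarith)
  have hMw2 : ∀ s ∈ Ioo (t - δ) (t + δ), ∀ x, ‖iteratedFDeriv ℝ 2 (curl (v s)) x‖ ≤ ‖curlCLM‖ * (K₃ / m ^ 2) := by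
    intro s hs x
    obtain ⟨hle, hs0⟩ := hms s hs
    refine (norm_iteratedFDeriv_two_curl_le (hsm s hs) x).trans (mul_le_mul_of_nonneg_left ?_ (norm_nonneg curlCLM))
    refine (hK₃ s hs0 x).trans (div_le_div_of_nonneg_left hK₃0 (by positivity) ?_)
    exact pow_le_pow_left₀ hm0.le hle 2
  exact hasDerivAt_windowedFlux_time hV hδ0 hδt hBu hMu hBw hMw hMw2 hL c

end Summit.NavierStokesRegularity.NavierStokesRegularity.Theorems.HalfSpaceWindowDoorCirculationCarryingRigidityPlaneFluxDynamics

end
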